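import Literature.Analysis.FluidPDE.TaoCascadeODEProofs
import Mathlib.Tactic.FinCases
import Mathlib.Tactic.Ring

/-!
# Crux `PerpetualPump.AveragedTypeIBlowup` (stmt-NavierStokesRegularity-1835), line `Sketch`:
# stub `todaLegal` — the seeded graded Toda circuit is a legal Tao cascade circuit

T. Tao, *Finite time blowup for an averaged three-dimensional Navier–Stokes equation*, J. Amer.
Math. Soc. **29** (2016), 601–674 = arXiv:1402.0290v3, §4: a cascade operator (4.1) is given by
structure constants `α_{i₁,i₂,i₃,μ₁,μ₂,μ₃}` (`i ∈ {1,…,m}`, `(μ₁,μ₂,μ₃) ∈ S`,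
`S = {(0,0,0),(1,0,0),(0,1,0),(0,0,1)}`) subject to the symmetry condition (4.2) and the
cancellation condition (4.3); the main term of the equation of motion (4.8) of the mode `(i,n)` is
the quadratic cascade nonlinearity `TaoCascade.quadTerm`.

This file proves the registered stub `stub_todaLegal` of the line's skeleton
(`Cruxes/AveragedTypeIBlowup/Lines/Sketch.lean`), verbatim. The line's circuit is the `m = 2`
SEEDED GRADED TODA circuit (mode `0` = carrier, mode `1` = bond; Toda coupling `c`, seed coupling
`ε`), with the nine non-zero structure constants
`α_{1,1,0,(0,0,0)} = c`, `α_{1,0,1,(0,0,0)} = α_{0,1,1,(0,0,0)} = -c/2`,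
`α_{1,0,1,(0,1,0)} = α_{0,1,1,(1,0,0)} = c/2`, `α_{1,1,0,(0,0,1)} = -c`,
`α_{0,0,1,(0,0,0)} = ε`, `α_{0,1,0,(0,0,0)} = α_{1,0,0,(0,0,0)} = -ε/2` (0-based modes). We show:

* the symmetry (4.2) and the cancellation (4.3) hold (a finite case check over `Fin 2³ × S`: the
  non-zero entries form three `S₃`-orbits, `{c, -c/2, -c/2}`, `{c/2, c/2, -c}`, `{ε, -ε/2, -ε/2}`,
  each summing to zero);
* the cascade nonlinearity is, in closed form, with `λₙ = (1+ε₀)^{5n/2}`,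
  `Q₀,ₙ = c λₙ Y₁,ₙ² − c λₙ₋₁ Y₁,ₙ₋₁² − ε λₙ Y₀,ₙ Y₁,ₙ` (carrier) and
  `Q₁,ₙ = c λₙ Y₁,ₙ (Y₀,ₙ₊₁ − Y₀,ₙ) + ε λₙ Y₀,ₙ²` (bond).

Everything is elementary algebra over the accepted vocabulary of
`Literature/Analysis/FluidPDE/TaoCascadeODE.lean` (`shiftSet`, `IsSymmetricCoeff`,
`IsCancellingCoeff`, `quadTerm`) and `TaoCascadeODEProofs.lean` (`sum_shiftSet`).
Nothing here closes the item (`--supports`); no statement of the route changes.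

## References

* T. Tao, J. Amer. Math. Soc. 29 (2016), 601–674, arXiv:1402.0290v3, §4 (4.1)–(4.3), (4.8);
  §6.1 Table 1 (the format of a structure-constant table). [`Tao2016AveragedNS`]
-/

noncomputable section

-- the summit namespace `…NavierStokesRegularity.NavierStokesRegularity…` is the tree convention
set_option linter.dupNamespace false

open MeasureTheory Set Filter Topology
open scoped ENNReal
open Literature.Analysis.FluidPDE
open Literature.Analysis.FluidPDE.TaoCascade (quadTerm IsSymmetricCoeff IsCancellingCoeff shiftSet
  mem_shiftSet_iff sum_shiftSet)

namespace Summit.NavierStokesRegularity.NavierStokesRegularity.Theorems.PerpetualPumpAveragedTypeIBlowup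

/-- **Stub `todaLegal`** (L1b). The structure constants of the SEEDED GRADED TODA CIRCUIT (`m = 2`,
mode `0` = carrier, mode `1` = bond; Toda coupling `c`, seed coupling `ε`) obey Tao's symmetry (4.2)
and cancellation (4.3), and their cascade nonlinearity is, in closed form,
`Q₀,ₙ = c λₙ Y₁,ₙ² − c λₙ₋₁ Y₁,ₙ₋₁² − ε λₙ Y₀,ₙ Y₁,ₙ`, `Q₁,ₙ = c λₙ Y₁,ₙ (Y₀,ₙ₊₁ − Y₀,ₙ) + ε λₙ Y₀,ₙ²`,
`λₙ = (1+ε₀)^{5n/2}` (a finite case check over `Fin 2³ × S`). [cite: Tao2016AveragedNS, §4 (4.2)–(4.3), §6.1 Table 2] -/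
theorem stub_todaLegal :
    ∀ c ε : ℝ,
      IsSymmetricCoeff (fun (i₁ i₂ i₃ : Fin 2) (μ : ℤ × ℤ × ℤ) =>
        if i₁ = 1 ∧ i₂ = 1 ∧ i₃ = 0 ∧ μ = (0, 0, 0) then c else
        if i₁ = 1 ∧ i₂ = 0 ∧ i₃ = 1 ∧ μ = (0, 0, 0) then -c / 2 else
        if i₁ = 0 ∧ i₂ = 1 ∧ i₃ = 1 ∧ μ = (0, 0, 0) then -c / 2 else
        if i₁ = 1 ∧ i₂ = 0 ∧ i₃ = 1 ∧ μ = (0, 1, 0) then c / 2 else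
        if i₁ = 0 ∧ i₂ = 1 ∧ i₃ = 1 ∧ μ = (1, 0, 0) then c / 2 else
        if i₁ = 1 ∧ i₂ = 1 ∧ i₃ = 0 ∧ μ = (0, 0, 1) then -c else
        if i₁ = 0 ∧ i₂ = 0 ∧ i₃ = 1 ∧ μ = (0, 0, 0) then ε else
        if i₁ = 0 ∧ i₂ = 1 ∧ i₃ = 0 ∧ μ = (0, 0, 0) then -ε / 2 else
        if i₁ = 1 ∧ i₂ = 0 ∧ i₃ = 0 ∧ μ = (0, 0, 0) then -ε / 2 else 0) ∧
      IsCancellingCoeff (fun (i₁ i₂ i₃ : Fin 2) (μ : ℤ × ℤ × ℤ) =>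
        if i₁ = 1 ∧ i₂ = 1 ∧ i₃ = 0 ∧ μ = (0, 0, 0) then c else
        if i₁ = 1 ∧ i₂ = 0 ∧ i₃ = 1 ∧ μ = (0, 0, 0) then -c / 2 else
        if i₁ = 0 ∧ i₂ = 1 ∧ i₃ = 1 ∧ μ = (0, 0, 0) then -c / 2 else
        if i₁ = 1 ∧ i₂ = 0 ∧ i₃ = 1 ∧ μ = (0, 1, 0) then c / 2 else
        if i₁ = 0 ∧ i₂ = 1 ∧ i₃ = 1 ∧ μ = (1, 0, 0) then c / 2 else
        if i₁ = 1 ∧ i₂ = 1 ∧ i₃ = 0 ∧ μ = (0, 0, 1) then -c else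
        if i₁ = 0 ∧ i₂ = 0 ∧ i₃ = 1 ∧ μ = (0, 0, 0) then ε else
        if i₁ = 0 ∧ i₂ = 1 ∧ i₃ = 0 ∧ μ = (0, 0, 0) then -ε / 2 else
        if i₁ = 1 ∧ i₂ = 0 ∧ i₃ = 0 ∧ μ = (0, 0, 0) then -ε / 2 else 0) ∧
      ∀ (ε₀ : ℝ) (Y : Fin 2 → ℤ → ℝ → ℝ) (n : ℤ) (t : ℝ),
        quadTerm ε₀ (fun (i₁ i₂ i₃ : Fin 2) (μ : ℤ × ℤ × ℤ) =>
          if i₁ = 1 ∧ i₂ = 1 ∧ i₃ = 0 ∧ μ = (0, 0, 0) then c else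
          if i₁ = 1 ∧ i₂ = 0 ∧ i₃ = 1 ∧ μ = (0, 0, 0) then -c / 2 else
          if i₁ = 0 ∧ i₂ = 1 ∧ i₃ = 1 ∧ μ = (0, 0, 0) then -c / 2 else
          if i₁ = 1 ∧ i₂ = 0 ∧ i₃ = 1 ∧ μ = (0, 1, 0) then c / 2 else
          if i₁ = 0 ∧ i₂ = 1 ∧ i₃ = 1 ∧ μ = (1, 0, 0) then c / 2 else
          if i₁ = 1 ∧ i₂ = 1 ∧ i₃ = 0 ∧ μ = (0, 0, 1) then -c else
          if i₁ = 0 ∧ i₂ = 0 ∧ i₃ = 1 ∧ μ = (0, 0, 0) then ε else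
          if i₁ = 0 ∧ i₂ = 1 ∧ i₃ = 0 ∧ μ = (0, 0, 0) then -ε / 2 else
          if i₁ = 1 ∧ i₂ = 0 ∧ i₃ = 0 ∧ μ = (0, 0, 0) then -ε / 2 else 0) Y 0 n t =
            c * (1 + ε₀) ^ ((5 : ℝ) * (n : ℝ) / 2) * Y 1 n t ^ 2 -
              c * (1 + ε₀) ^ ((5 : ℝ) * ((n : ℝ) - 1) / 2) * Y 1 (n - 1) t ^ 2 -
              ε * (1 + ε₀) ^ ((5 : ℝ) * (n : ℝ) / 2) * (Y 0 n t * Y 1 n t) ∧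
        quadTerm ε₀ (fun (i₁ i₂ i₃ : Fin 2) (μ : ℤ × ℤ × ℤ) =>
          if i₁ = 1 ∧ i₂ = 1 ∧ i₃ = 0 ∧ μ = (0, 0, 0) then c else
          if i₁ = 1 ∧ i₂ = 0 ∧ i₃ = 1 ∧ μ = (0, 0, 0) then -c / 2 else
          if i₁ = 0 ∧ i₂ = 1 ∧ i₃ = 1 ∧ μ = (0, 0, 0) then -c / 2 else
          if i₁ = 1 ∧ i₂ = 0 ∧ i₃ = 1 ∧ μ = (0, 1, 0) then c / 2 else
          if i₁ = 0 ∧ i₂ = 1 ∧ i₃ = 1 ∧ μ = (1, 0, 0) then c / 2 else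
          if i₁ = 1 ∧ i₂ = 1 ∧ i₃ = 0 ∧ μ = (0, 0, 1) then -c else
          if i₁ = 0 ∧ i₂ = 0 ∧ i₃ = 1 ∧ μ = (0, 0, 0) then ε else
          if i₁ = 0 ∧ i₂ = 1 ∧ i₃ = 0 ∧ μ = (0, 0, 0) then -ε / 2 else
          if i₁ = 1 ∧ i₂ = 0 ∧ i₃ = 0 ∧ μ = (0, 0, 0) then -ε / 2 else 0) Y 1 n t =
            c * (1 + ε₀) ^ ((5 : ℝ) * (n : ℝ) / 2) * (Y 1 n t * (Y 0 (n + 1) t - Y 0 n t)) +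
              ε * (1 + ε₀) ^ ((5 : ℝ) * (n : ℝ) / 2) * Y 0 n t ^ 2 := by
  intro c ε
  refine ⟨?_, ?_, ?_⟩
  · intro i₁ i₂ i₃ μ₁ μ₂ μ₃ hμ
    simp only [mem_shiftSet_iff, Prod.mk.injEq] at hμ
    rcases hμ with ⟨rfl, rfl, rfl⟩ | ⟨rfl, rfl, rfl⟩ | ⟨rfl, rfl, rfl⟩ | ⟨rfl, rfl, rfl⟩ <;>
      fin_cases i₁ <;> fin_cases i₂ <;> fin_cases i₃ <;>
        simp only [Fin.zero_eta, Fin.isValue, Fin.mk_one, zero_ne_one, one_ne_zero, and_self,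
          and_true, and_false, ↓reduceIte, Prod.mk.injEq]
  · intro i₁ i₂ i₃ μ₁ μ₂ μ₃ hμ
    simp only [mem_shiftSet_iff, Prod.mk.injEq] at hμ
    rcases hμ with ⟨rfl, rfl, rfl⟩ | ⟨rfl, rfl, rfl⟩ | ⟨rfl, rfl, rfl⟩ | ⟨rfl, rfl, rfl⟩ <;>
      fin_cases i₁ <;> fin_cases i₂ <;> fin_cases i₃ <;>
        simp only [Fin.zero_eta, Fin.isValue, Fin.mk_one, zero_ne_one, one_ne_zero, and_self,
          and_true, and_false, ↓reduceIte, Prod.mk.injEq] <;> ring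
  · intro ε₀ Y n t
    constructor
    · simp only [quadTerm, Fin.sum_univ_two, sum_shiftSet, Fin.isValue, Prod.mk.injEq, true_and,
        and_true, and_self, false_and, and_false, zero_ne_one, one_ne_zero, ↓reduceIte, zero_mul,
        Int.cast_zero, Int.cast_one, sub_zero, add_zero]
      ring
    · simp only [quadTerm, Fin.sum_univ_two, sum_shiftSet, Fin.isValue, Prod.mk.injEq, true_and,
        and_true, and_self, false_and, and_false, zero_ne_one, one_ne_zero, ↓reduceIte, zero_mul,
        Int.cast_zero, sub_zero, add_zero]
      ring

end Summit.NavierStokesRegularity.NavierStokesRegularity.Theorems.PerpetualPumpAveragedTypeIBlowup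

end
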